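import Mathlib
import Summits.ValiantsHypothesis.ValiantsHypothesis.Theorems.RigidityForcesSymmetryRankRigidMinimalReprLaplaceFiveStarDictionary

/-!
# ValiantsHypothesis / RigidityForcesSymmetry — crux `LaplaceOptimalFive` (stmt-ValiantsHypothesis-24813), crux idea
`young-shadow` (K1) on the star: **LETTER ↔ POLYNOMIAL CONVERSIONS FOR FIBRE SUMS** (wiring)
(memo `NOTE-p4g15-24813-K1-star.md` §1/§9 dictionary; memo `NOTE-p4g16-24813-LemmaK-kernel.md` r2 §4 (iv))

For a fibre sum `H(A,B|C,D,E) = Σ_{t ∈ F} U_t(A,B)·W_t(C,D,E)` of letter tensors: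
* `cubicMatrix_of_fibre` — `Σ_{CDE} H(A,B,C,D,E) X_CX_DX_E = Σ_t C(U_t(A,B))·K_t` (`K_t` the cubic of `W_t`);
* `quintic_of_fibre` — `Σ_{ABCDE} H X_AX_BX_CX_DX_E = Σ_t Q_t·K_t`;
* `slack_poly` — with the symmetries, the cubic matrix of the letter slack `E = H − (1/10)S_H` is
  `Σ_{CDE} E(A,B,C,D,E) X_CX_DX_E = C_{AB} − C(1/20)·∂_A∂_B F_H` (✓ `pairSum_cubic_eq_hessian`);
* `slack_eq_of_cross_symmetric` — if `H' − H` is cross-symmetric (✓ `star_slack_sum`'s `hD`) then `E(H') = E(H)` letter-wise: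
  the slack is COMMON to all fibres;
* `exchange33_of_closed44` — the `4+4` letter closedness of a two-term fibre (✓ `star_letter_reading`) is the `3+3` exchange
  identity `(C_H)` consumed by ✓ `lemma_two_prime` / ✓ `t1_rebase`.

No definitions, no `sorry`.  Honest framing: wiring brick, closes nothing; K1-on-the-star PAPER PASS, not kernel;
`LaplaceOptimalFive` OPEN · CONTESTED 72/120; `VP ≠ VNP` NOT proved.
-/

set_option linter.dupNamespace false

namespace Summit.ValiantsHypothesis.ValiantsHypothesis.Theorems.RigidityForcesSymmetryRankRigidMinimalRepr

namespace LaplaceFiveStar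

open Finset MvPolynomial

variable {N : ℕ}

/-- Cubic matrix of a fibre sum. [folklore] -/
theorem cubicMatrix_of_fibre (F : Finset (Fin N)) (U : Fin N → Fin 5 → Fin 5 → ℂ) (W : Fin N → Fin 5 → Fin 5 → Fin 5 → ℂ)
    (A B : Fin 5) :
    (∑ c : Fin 5, ∑ d : Fin 5, ∑ e : Fin 5, C (∑ t ∈ F, U t A B * W t c d e) * X c * X d * X e : MvPolynomial (Fin 5) ℂ)
      = ∑ t ∈ F, C (U t A B) * ∑ c : Fin 5, ∑ d : Fin 5, ∑ e : Fin 5, C (W t c d e) * X c * X d * X e := by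
  have h : ∀ c d e : Fin 5, (C (∑ t ∈ F, U t A B * W t c d e) * X c * X d * X e : MvPolynomial (Fin 5) ℂ)
      = ∑ t ∈ F, C (U t A B) * (C (W t c d e) * X c * X d * X e) := by
    intro c d e
    simp only [map_sum, map_mul, Finset.sum_mul]
    exact Finset.sum_congr rfl fun t _ => by ring
  simp only [h]
  have s1 : (∑ c : Fin 5, ∑ d : Fin 5, ∑ e : Fin 5, ∑ t ∈ F, C (U t A B) * (C (W t c d e) * X c * X d * X e)
        : MvPolynomial (Fin 5) ℂ)
      = ∑ c : Fin 5, ∑ d : Fin 5, ∑ t ∈ F, ∑ e : Fin 5, C (U t A B) * (C (W t c d e) * X c * X d * X e) :=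
    Finset.sum_congr rfl fun c _ => Finset.sum_congr rfl fun d _ => Finset.sum_comm
  have s2 : (∑ c : Fin 5, ∑ d : Fin 5, ∑ t ∈ F, ∑ e : Fin 5, C (U t A B) * (C (W t c d e) * X c * X d * X e)
        : MvPolynomial (Fin 5) ℂ)
      = ∑ c : Fin 5, ∑ t ∈ F, ∑ d : Fin 5, ∑ e : Fin 5, C (U t A B) * (C (W t c d e) * X c * X d * X e) :=
    Finset.sum_congr rfl fun c _ => Finset.sum_comm
  have s3 : (∑ c : Fin 5, ∑ t ∈ F, ∑ d : Fin 5, ∑ e : Fin 5, C (U t A B) * (C (W t c d e) * X c * X d * X e)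
        : MvPolynomial (Fin 5) ℂ)
      = ∑ t ∈ F, ∑ c : Fin 5, ∑ d : Fin 5, ∑ e : Fin 5, C (U t A B) * (C (W t c d e) * X c * X d * X e) :=
    Finset.sum_comm
  rw [s1, s2, s3]
  refine Finset.sum_congr rfl fun t _ => ?_
  simp only [Finset.mul_sum]

/-- Quintic of a fibre sum. [folklore] -/
theorem quintic_of_fibre (F : Finset (Fin N)) (U : Fin N → Fin 5 → Fin 5 → ℂ) (W : Fin N → Fin 5 → Fin 5 → Fin 5 → ℂ) :
    (∑ a : Fin 5, ∑ b : Fin 5, ∑ c : Fin 5, ∑ d : Fin 5, ∑ e : Fin 5,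
        C (∑ t ∈ F, U t a b * W t c d e) * X a * X b * X c * X d * X e : MvPolynomial (Fin 5) ℂ)
      = ∑ t ∈ F, (∑ a : Fin 5, ∑ b : Fin 5, C (U t a b) * X a * X b) *
          (∑ c : Fin 5, ∑ d : Fin 5, ∑ e : Fin 5, C (W t c d e) * X c * X d * X e) := by
  have h1 : ∀ a b : Fin 5, (∑ c : Fin 5, ∑ d : Fin 5, ∑ e : Fin 5,
      C (∑ t ∈ F, U t a b * W t c d e) * X a * X b * X c * X d * X e : MvPolynomial (Fin 5) ℂ)
      = X a * X b * ∑ c : Fin 5, ∑ d : Fin 5, ∑ e : Fin 5, C (∑ t ∈ F, U t a b * W t c d e) * X c * X d * X e := by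
    intro a b
    rw [Finset.mul_sum]
    refine Finset.sum_congr rfl fun c _ => ?_
    rw [Finset.mul_sum]
    refine Finset.sum_congr rfl fun d _ => ?_
    rw [Finset.mul_sum]
    exact Finset.sum_congr rfl fun e _ => by ring
  -- both sides equal `Σ_t Σ_a Σ_b C(U_t ab) X_a X_b K_t`
  have lhs : (∑ a : Fin 5, ∑ b : Fin 5, ∑ c : Fin 5, ∑ d : Fin 5, ∑ e : Fin 5,
        C (∑ t ∈ F, U t a b * W t c d e) * X a * X b * X c * X d * X e : MvPolynomial (Fin 5) ℂ)
      = ∑ t ∈ F, ∑ a : Fin 5, ∑ b : Fin 5, C (U t a b) * X a * X b *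
          (∑ c : Fin 5, ∑ d : Fin 5, ∑ e : Fin 5, C (W t c d e) * X c * X d * X e) := by
    rw [show (∑ a : Fin 5, ∑ b : Fin 5, ∑ c : Fin 5, ∑ d : Fin 5, ∑ e : Fin 5,
        C (∑ t ∈ F, U t a b * W t c d e) * X a * X b * X c * X d * X e : MvPolynomial (Fin 5) ℂ)
        = ∑ a : Fin 5, ∑ b : Fin 5, ∑ t ∈ F, X a * X b * (C (U t a b) *
            ∑ c : Fin 5, ∑ d : Fin 5, ∑ e : Fin 5, C (W t c d e) * X c * X d * X e) from
      Finset.sum_congr rfl fun a _ => Finset.sum_congr rfl fun b _ => by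
        rw [h1, cubicMatrix_of_fibre, Finset.mul_sum]]
    have s1 : (∑ a : Fin 5, ∑ b : Fin 5, ∑ t ∈ F, X a * X b * (C (U t a b) *
            ∑ c : Fin 5, ∑ d : Fin 5, ∑ e : Fin 5, C (W t c d e) * X c * X d * X e) : MvPolynomial (Fin 5) ℂ)
        = ∑ a : Fin 5, ∑ t ∈ F, ∑ b : Fin 5, X a * X b * (C (U t a b) *
            ∑ c : Fin 5, ∑ d : Fin 5, ∑ e : Fin 5, C (W t c d e) * X c * X d * X e) :=
      Finset.sum_congr rfl fun a _ => Finset.sum_comm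
    rw [s1, Finset.sum_comm]
    exact Finset.sum_congr rfl fun t _ => Finset.sum_congr rfl fun a _ => Finset.sum_congr rfl fun b _ => by ring
  rw [lhs]
  refine Finset.sum_congr rfl fun t _ => ?_
  rw [Finset.sum_mul]
  refine Finset.sum_congr rfl fun a _ => ?_
  rw [Finset.sum_mul]

/-- **The cubic matrix of the letter slack** `E = H − (1/10)S_H`: `Σ_{CDE} E(A,B,C,D,E)X_CX_DX_E = C_{AB} − (1/20)∂_A∂_B F_H`.
[folklore] -/
theorem slack_poly (H : Fin 5 → Fin 5 → Fin 5 → Fin 5 → Fin 5 → ℂ)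
    (h12 : ∀ a b c d e : Fin 5, H a b c d e = H b a c d e) (h34 : ∀ a b c d e : Fin 5, H a b c d e = H a b d c e)
    (h45 : ∀ a b c d e : Fin 5, H a b c d e = H a b c e d) (A B : Fin 5) :
    (∑ c : Fin 5, ∑ d : Fin 5, ∑ e : Fin 5,
        C (H A B c d e - (1 / 10 : ℂ) * (H A B c d e + H A c B d e + H A d B c e + H A e B c d + H B c A d e + H B d A c e
          + H B e A c d + H c d A B e + H c e A B d + H d e A B c)) * X c * X d * X e : MvPolynomial (Fin 5) ℂ)
      = (∑ c : Fin 5, ∑ d : Fin 5, ∑ e : Fin 5, C (H A B c d e) * X c * X d * X e)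
        - C (1 / 20 : ℂ) * pderiv A (pderiv B (∑ i : Fin 5, ∑ j : Fin 5, ∑ k : Fin 5, ∑ l : Fin 5, ∑ m : Fin 5,
            C (H i j k l m) * X i * X j * X k * X l * X m : MvPolynomial (Fin 5) ℂ)) := by
  rw [← pairSum_cubic_eq_hessian H h12 h34 h45 A B]
  rw [cubicSum_add _ (fun c d e => H A B c d e)
      (fun c d e => (-(1 / 10 : ℂ)) * (H A B c d e + H A c B d e + H A d B c e + H A e B c d + H B c A d e + H B d A c e
          + H B e A c d + H c d A B e + H c e A B d + H d e A B c)) (fun c d e => by ring),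
    cubicSum_smul]
  have hc : (C (1 / 10 : ℂ) : MvPolynomial (Fin 5) ℂ) = C (1 / 20 : ℂ) * 2 := by
    rw [show (2 : MvPolynomial (Fin 5) ℂ) = C (2 : ℂ) from (map_ofNat C 2).symm, ← map_mul]
    norm_num
  simp only [map_neg]
  rw [hc]
  ring

/-- **The slack is common to all fibres**: if `H' − H` is cross-symmetric (and both are side-symmetric) then
`H' − (1/10)S_{H'} = H − (1/10)S_H`. [folklore] -/
theorem slack_eq_of_cross_symmetric (H H' : Fin 5 → Fin 5 → Fin 5 → Fin 5 → Fin 5 → ℂ)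
    (h12 : ∀ a b c d e : Fin 5, H a b c d e = H b a c d e) (h34 : ∀ a b c d e : Fin 5, H a b c d e = H a b d c e)
    (h45 : ∀ a b c d e : Fin 5, H a b c d e = H a b c e d)
    (h12' : ∀ a b c d e : Fin 5, H' a b c d e = H' b a c d e) (h34' : ∀ a b c d e : Fin 5, H' a b c d e = H' a b d c e)
    (h45' : ∀ a b c d e : Fin 5, H' a b c d e = H' a b c e d)
    (hD : ∀ a b c d e : Fin 5, H' a b c d e - H a b c d e = H' a c b d e - H a c b d e) (a b c d e : Fin 5) :
    H' a b c d e - (1 / 10 : ℂ) * (H' a b c d e + H' a c b d e + H' a d b c e + H' a e b c d + H' b c a d e + H' b d a c e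
        + H' b e a c d + H' c d a b e + H' c e a b d + H' d e a b c)
      = H a b c d e - (1 / 10 : ℂ) * (H a b c d e + H a c b d e + H a d b c e + H a e b c d + H b c a d e + H b d a c e
        + H b e a c d + H c d a b e + H c e a b d + H d e a b c) := by
  -- the difference `D` is invariant under the adjacent transpositions, hence under every argument permutation used
  set D : Fin 5 → Fin 5 → Fin 5 → Fin 5 → Fin 5 → ℂ := fun a b c d e => H' a b c d e - H a b c d e with hDdef
  have d12 : ∀ a b c d e : Fin 5, D a b c d e = D b a c d e := fun a b c d e => by simp only [hDdef]; rw [h12, h12']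
  have d23 : ∀ a b c d e : Fin 5, D a b c d e = D a c b d e := fun a b c d e => hD a b c d e
  have d34 : ∀ a b c d e : Fin 5, D a b c d e = D a b d c e := fun a b c d e => by simp only [hDdef]; rw [h34, h34']
  have d45 : ∀ a b c d e : Fin 5, D a b c d e = D a b c e d := fun a b c d e => by simp only [hDdef]; rw [h45, h45']
  have e2 : D a c b d e = D a b c d e := (d23 a b c d e).symm
  have e3 : D a d b c e = D a b c d e := by rw [d23 a d b c e, d34 a b d c e]
  have e4 : D a e b c d = D a b c d e := by rw [d23 a e b c d, d34 a b e c d, d45 a b c e d]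
  have e5 : D b c a d e = D a b c d e := by rw [d12 b c a d e, d23 c b a d e, d12 c a b d e, d23 a c b d e]
  have e6 : D b d a c e = D a b c d e := by rw [d23 b d a c e, d12 b a d c e, d34 a b d c e]
  have e7 : D b e a c d = D a b c d e := by rw [d23 b e a c d, d12 b a e c d, d34 a b e c d, d45 a b c e d]
  have e8 : D c d a b e = D a b c d e := by
    rw [d23 c d a b e, d12 c a d b e, d34 a c d b e, d23 a c b d e, d34 a b c d e, d34 a b d c e]
  have e9 : D c e a b d = D a b c d e := by
    rw [d23 c e a b d, d12 c a e b d, d34 a c e b d, d23 a c b e d, d45 a b c e d]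
  have e10 : D d e a b c = D a b c d e := by
    rw [d23 d e a b c, d12 d a e b c, d34 a d e b c, d23 a d b e c, d45 a b d e c, d34 a b d c e]
  have key : ∀ x y z w u : Fin 5, H' x y z w u = H x y z w u + D x y z w u := fun x y z w u => by simp only [hDdef]; ring
  simp only [key]
  linear_combination (-(1 / 10 : ℂ)) * (e2 + e3 + e4 + e5 + e6 + e7 + e8 + e9 + e10)

/-- **`4+4` letter closedness ⟹ the `3+3` exchange identity `(C_H)`** for a two-term fibre. [folklore] -/
theorem exchange33_of_closed44 (U₁ U₂ : Fin 5 → Fin 5 → ℂ) (W₁ W₂ : Fin 5 → Fin 5 → Fin 5 → ℂ)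
    (hU1 : ∀ a b : Fin 5, U₁ a b = U₁ b a) (hU2 : ∀ a b : Fin 5, U₂ a b = U₂ b a)
    (hW1a : ∀ a b c : Fin 5, W₁ a b c = W₁ b a c) (hW1b : ∀ a b c : Fin 5, W₁ a b c = W₁ a c b)
    (hW2a : ∀ a b c : Fin 5, W₂ a b c = W₂ b a c) (hW2b : ∀ a b c : Fin 5, W₂ a b c = W₂ a c b)
    (hC : ∀ A B C D E : Fin 5,
      (U₁ A B * W₁ C D E + U₂ A B * W₂ C D E) + (U₁ A C * W₁ B D E + U₂ A C * W₂ B D E)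
        + (U₁ A D * W₁ C B E + U₂ A D * W₂ C B E) + (U₁ A E * W₁ C D B + U₂ A E * W₂ C D B)
      = (U₁ B A * W₁ C D E + U₂ B A * W₂ C D E) + (U₁ B C * W₁ A D E + U₂ B C * W₂ A D E)
        + (U₁ B D * W₁ C A E + U₂ B D * W₂ C A E) + (U₁ B E * W₁ C D A + U₂ B E * W₂ C D A))
    (A B C D E : Fin 5) :
    (U₁ A C * W₁ B D E + U₁ A D * W₁ B C E + U₁ A E * W₁ B C D)
        + (U₂ A C * W₂ B D E + U₂ A D * W₂ B C E + U₂ A E * W₂ B C D)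
      = (U₁ B C * W₁ A D E + U₁ B D * W₁ A C E + U₁ B E * W₁ A C D)
        + (U₂ B C * W₂ A D E + U₂ B D * W₂ A C E + U₂ B E * W₂ A C D) := by
  have h := hC A B C D E
  rw [hU1 B A, hU2 B A, hW1a C B E, hW2a C B E, hW1a C A E, hW2a C A E, hW1b C D B, hW1a C B D, hW2b C D B, hW2a C B D,
    hW1b C D A, hW1a C A D, hW2b C D A, hW2a C A D] at h
  linear_combination h

end LaplaceFiveStar

end Summit.ValiantsHypothesis.ValiantsHypothesis.Theorems.RigidityForcesSymmetryRankRigidMinimalRepr
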